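import Literature.Geometry.Kaehler.ComplexTorusEquivariantEndomorphismAlgebraCommutantCMTypeCriterion
import Literature.Geometry.Kaehler.ComplexTorusTangentSpaceGroupAction
import HarnessLib

/-!
# The criterion through the analytic representation: `End_ℚ^G(X) = End_{ℚ[G]}(H₁(X,ℚ))` iff the analytic
# representation `ρ_a : G → GL(T_0X)` and its complex conjugate `ρ̄_a` have no irreducible constituent in common

Layer `Literature/Geometry/Kaehler`, namespace `Literature.Geometry.Kaehler.ComplexTorus`; lane `lit-hodgefound`
(Track 2 foundations library), Layer A2, row «A2-26(dn)» (self-proposed 2026-08-27, prover seat `lit-hodgefound-p10`,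
generation 23, FILE 8).  Sequel of FILE 4 `…CommutantCMTypeCriterion.lean` (`complexGroupAlgebraRep ρ = ρ_ℂ`, the
isotypic projectors `P_χ = ρ_ℂ(e_χ)`, THE CM-TYPE CRITERION: equality iff `J_ℂ P_χ = ±i P_χ` for every `χ ∈ Irr(G)`,
`jMatrix_mul_charIdempotent_eq_I_smul_or`, `jMatrix_mul_charIdempotent_star_eq_conj_smul`,
`map_conj_complexGroupAlgebraRep_charIdempotent`) and of generation 17's `ComplexTorusTangentSpaceGroupAction.lean`
(**`tangentRep ρ : Representation ℂ G E`**, the analytic representation `ρ_a` of the action on `E = T_0X`,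
`tangentRep_apply_apply`: `ρ_a(g)(Φ x) = Φ(ρ(g) x)`).  CONSUMED BY NAME: skel's `jMatrix`, `jMatrix_mulVec`,
`apply_latticeJ`, `jMatrix_mul_jMatrix`; p38's `charIdempotent`, `isIdempotentElem_charIdempotent`,
`IsIrrChar.star`, `IsIrrChar.apply_one_ne_zero`, `Representation.asAlgebraHom_charIdempotent` (`ρ(e_χ)` is the
isotypic projector `isotypicProj ρ χ`), `trace_isotypicProj` (`tr P_χ = χ(1)⟨χ, χ_ρ⟩`), `classInner`,
`classInner_star_star`; Mathlib's `Representation.asAlgebraHom`, `LinearMap.IsProj.trace`.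

## The mathematics

`H₁(X,ℂ) = Λ ⊗ ℂ = V^{-1,0} ⊕ V^{0,-1}`, the `±i`-eigenspaces of `J_ℂ = J ⊗ 1`, and `V^{-1,0} ≅ (Λ ⊗ ℝ, J) ≅ T_0X = E`
as `G`-modules: the `ℂ`-linear extension `κ : Λ ⊗ ℂ → E` of the period isomorphism `Φ : Λ ⊗ ℝ ≃ E` (`x ⊗ z ↦ z Φ(x)`)
is surjective, kills `V^{0,-1}`, is injective on `V^{-1,0}`, and intertwines `ρ(g) ⊗ 1` with `ρ_a(g)` — this is
"`ρ_r ⊗ 1 ≃ ρ_a ⊕ \overline{ρ_a}`" (2.6).  Hence for the isotypic projector `P_χ = ρ_ℂ(e_χ)` (which commutes with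
`J_ℂ`): `ρ_a(e_χ) = 0 ⟺ κ P_χ = 0 ⟺ P_χ(Λ ⊗ ℂ) ⊆ V^{0,-1} ⟺ J_ℂ P_χ = -i P_χ`, and, conjugating, `ρ_a(e_{χ̄}) = 0 ⟺
J_ℂ P_χ = +i P_χ`.  FILE 4's criterion "each `P_χ` is of one Hodge type" therefore reads: **equality iff for every
irreducible `χ` at least one of `χ`, `χ̄` is absent from `ρ_a`**, i.e. iff `⟨χ, χ_a⟩ ⟨χ̄, χ_a⟩ = 0` for all
`χ ∈ Irr(G)` (`χ_a` the character of `ρ_a`; `⟨χ̄, χ_a⟩ = \overline{⟨χ, χ̄_a⟩}` is the multiplicity of `χ` in `ρ̄_a`).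

## Sources, VERBATIM (held texts)

* H. Lange, R. E. Rodríguez, *Decomposition of Jacobians by Prym Varieties*, LNM 2310 (2022; held
  `book:lange2022-decomposition-jacobians-by-prym-varieties`), §2.2 p0029: "(2.6) `ρ_r ⊗ 1 ≃ ρ_a ⊕ \overline{ρ_a}`";
  §2.9.2 p0046: "Let `V` be a complex representation of a finite group `G` […] applied to the tangent space".
* H. Lange, *Abelian Varieties over the Complex Numbers* (2023), §1.1.2 Prop. 1.1.6 (`End_ℚ(X)` = rational matrices
  commuting with `J`), Prop. 1.1.9 ("`ρ_r ⊗ 1 ≃ ρ_a ⊕ \overline{ρ_a}`"), §7.1.1 Prop. 7.1.1 (proof: "`V^{-1,0} = V_{+1}`,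
  `\overline{V_{+1}} = V_{-1}`", `V_ℂ/F⁰ ≅ V^{-1,0} = Lie(X)`).
* I. Dolgachev, Yu. G. Zarhin, *Endomorphisms of Complex Abelian Varieties* (2024; held
  `paper:galaxy-pdf-8712177384607648460`), §2.2 p0035–p0036, Remark 2.17 / (2.18) and Thm. 2.18.
* I. M. Isaacs, *Character Theory of Finite Groups* (1976; held), Thm. 2.12 (the `e_χ`), Ch. 3 p. 36 (traces of
  `ρ(z)`); J.-P. Serre, *Linear Representations of Finite Groups*, §2.6 Thm. 8 (the isotypic projector and its trace);
  G. James, M. Liebeck, *Representations and Characters of Groups* (2001), §13 Prop. 13.15 (`χ̄`), §23 Thm. 23.1.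

## What is proved (ONE definition with body, `cxPeriod`; theorems; NO named fact, no `sorry`)

`X = E/Φ(ℤ^ι)`, `ρ : G →* End_ℚ(X)`, `J_ℂ = (jMatrix Φ) ⊗ ℂ`, `P_χ = complexGroupAlgebraRep ρ (charIdempotent χ)`,
`ρ_a = tangentRep ρ`, `ρ_a(x) = (tangentRep ρ).asAlgebraHom x` for `x ∈ ℂ[G]`.
* §1 **`cxPeriod Φ : (ι → ℂ) →ₗ[ℂ] E`** (`z ↦ Σ_i z_i Φ(e_i)`): `cxPeriod_apply`, `cxPeriod_single`, `cxPeriod_ofReal` (`= Φ` on real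
  vectors), `cxPeriod_eq_re_add_im`, `cxPeriod_surjective`, `cxPeriod_comp_toLin'_map_ofReal` (intertwining from a real
  intertwining), `cxPeriod_jMatrix_mulVec` (`κ ∘ J_ℂ = i κ`), `cxPeriod_map_ratCast_mulVec` (`κ ∘ (ρ g ⊗ 1) = ρ_a(g) ∘ κ`),
  **`cxPeriod_complexGroupAlgebraRep_mulVec`** (`κ ∘ ρ_ℂ(x) = ρ_a(x) ∘ κ`), `cxPeriod_eq_zero_of_jMatrix_mulVec_eq_neg`
  (`κ` kills `V^{0,-1}`), `eq_zero_of_jMatrix_mulVec_eq_of_cxPeriod_eq_zero` (`κ` is injective on `V^{-1,0}`).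
* §2 THE BRIDGE: `map_ofReal_jMatrix_mul_complexGroupAlgebraRep` (`J_ℂ` commutes with `ρ_ℂ(x)`),
  **`asAlgebraHom_tangentRep_eq_zero_iff`** (for any `x ∈ ℂ[G]`: `ρ_a(x) = 0 ⟺ J_ℂ ρ_ℂ(x) = -i ρ_ℂ(x)`),
  **`asAlgebraHom_tangentRep_charIdempotent_star_eq_zero_iff`** (`ρ_a(e_{χ̄}) = 0 ⟺ J_ℂ P_χ = i P_χ`).
* §3 **THE ANALYTIC CRITERION `endAlgRatG_eq_centralizer_iff_forall_tangentRep`: equality ⟺ ∀ χ ∈ Irr(G),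
  ρ_a(e_χ) = 0 ∨ ρ_a(e_{χ̄}) = 0`**; `asAlgebraHom_tangentRep_charIdempotent_eq_zero_of_star_eq` (a real-valued `χ`
  is absent from `ρ_a` in the equality case).
* §4 IN CHARACTERS (`E` finite-dimensional over `ℂ`, `χ_a = (tangentRep ρ).character`):
  `asAlgebraHom_tangentRep_charIdempotent_eq_zero_iff_classInner` (`ρ_a(e_χ) = 0 ⟺ ⟨χ, χ_a⟩ = 0`),
  `classInner_star_left_eq_zero_iff` (`⟨χ̄, χ_a⟩ = 0 ⟺ ⟨χ, χ̄_a⟩ = 0`), and **`endAlgRatG_eq_centralizer_iff_forall_classInner`: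
  equality ⟺ ∀ χ ∈ Irr(G), ⟨χ, χ_a⟩ = 0 ∨ ⟨χ, \overline{χ_a}⟩ = 0** — `ρ_a` and `ρ̄_a` are disjoint;
  `endAlgRatG_ne_centralizer_of_classInner_ne_zero` (a common constituent forces `End_ℚ^G(X) ⊊ C(ρ)`).

## References

* [LangeRodriguez2022] H. Lange, R. E. Rodríguez, *Decomposition of Jacobians by Prym Varieties*, LNM 2310 (2022),
  §2.2 (2.6)–(2.8); §2.9.2 Lemma 2.9.4.
* [Lange2023AbelianVarietiesComplex] H. Lange, *Abelian Varieties over the Complex Numbers* (2023), §1.1.2 Props.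
  1.1.6, 1.1.9; §7.1.1 Prop. 7.1.1.
* [DolgachevZarhin2024] I. Dolgachev, Yu. G. Zarhin, *Endomorphisms of Complex Abelian Varieties* (2024), §2.2
  Remark 2.17, (2.18), Thm. 2.18.
* [Isaacs1976] I. M. Isaacs, *Character Theory of Finite Groups* (1976), Thm. 2.12; Ch. 3 p. 36.
* [SerreLinearRepresentations1977] J.-P. Serre, *Linear Representations of Finite Groups* (1977), §2.6 Thm. 8.
* [JamesLiebeck2001] G. James, M. Liebeck, *Representations and Characters of Groups* (2001), §13 Prop. 13.15, §23.
-/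

noncomputable section

open Module Function
open scoped Matrix

namespace Literature.Geometry.Kaehler

namespace ComplexTorus

open Literature.RepresentationTheory.FiniteGroups

universe u

/-! #### Private helpers -/

section Helpers

/-- `M ⊗_ℚ ℂ = (M ⊗_ℚ ℝ) ⊗_ℝ ℂ`. [folklore] -/
private theorem map_ratCast_complex_a {m : Type*} (M : Matrix m m ℚ) :
    M.map (Rat.cast : ℚ → ℂ) = (M.map (Rat.cast : ℚ → ℝ)).map ((↑) : ℝ → ℂ) := by
  ext i j
  simp only [Matrix.map_apply, Complex.ofReal_ratCast]

/-- `(A B) ⊗ ℂ = (A ⊗ ℂ)(B ⊗ ℂ)`. [folklore] -/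
private theorem map_ofReal_mul_a {m : Type*} [Fintype m] (A B : Matrix m m ℝ) :
    (A * B).map ((↑) : ℝ → ℂ) = A.map ((↑) : ℝ → ℂ) * B.map ((↑) : ℝ → ℂ) :=
  Matrix.map_mul (f := Complex.ofRealHom)

/-- Conjugating `A ⊗ ℂ` entrywise does nothing for real `A`. [folklore] -/
private theorem map_conj_map_ofReal_a {m : Type*} (A : Matrix m m ℝ) :
    (A.map ((↑) : ℝ → ℂ)).map (starRingEnd ℂ) = A.map ((↑) : ℝ → ℂ) := by
  ext i j
  simp only [Matrix.map_apply, Complex.conj_ofReal]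

/-- `conj (A B) = conj A conj B` entrywise. [folklore] -/
private theorem map_conj_mul_a {m : Type*} [Fintype m] (A B : Matrix m m ℂ) :
    (A * B).map (starRingEnd ℂ) = A.map (starRingEnd ℂ) * B.map (starRingEnd ℂ) :=
  Matrix.map_mul (f := starRingEnd ℂ)

/-- `conj (c P) = c̄ conj P`. [folklore] -/
private theorem map_conj_smul_a {m : Type*} (c : ℂ) (P : Matrix m m ℂ) :
    (c • P).map (starRingEnd ℂ) = starRingEnd ℂ c • P.map (starRingEnd ℂ) := by
  ext i j
  simp only [Matrix.map_apply, Matrix.smul_apply, smul_eq_mul, map_mul]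

/-- `conj (-P) = -conj P`. [folklore] -/
private theorem map_conj_neg_a {m : Type*} (P : Matrix m m ℂ) :
    (-P).map (starRingEnd ℂ) = -P.map (starRingEnd ℂ) := by
  ext i j
  simp only [Matrix.map_apply, Matrix.neg_apply, map_neg]

/-- Entrywise conjugation of complex matrices is injective. [folklore] -/
private theorem map_conj_injective_a {m : Type*} : Function.Injective fun M : Matrix m m ℂ ↦ M.map (starRingEnd ℂ) :=
  Matrix.map_injective (RingHom.injective _)

/-- The standard complex basis vector is the complexified real one. [folklore] -/
private theorem single_eq_ofReal_single_a {ι : Type*} [DecidableEq ι] (j : ι) :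
    (Pi.single j (1 : ℂ) : ι → ℂ) = fun i ↦ ((Pi.single j (1 : ℝ) : ι → ℝ) i : ℂ) := by
  funext i
  rw [Pi.single_apply, Pi.single_apply, apply_ite ((↑) : ℝ → ℂ), Complex.ofReal_one, Complex.ofReal_zero]

/-- `(M ⊗ ℂ) e_j = (M e_j) ⊗ 1`. [folklore] -/
private theorem map_ofReal_mulVec_single_a {ι : Type*} [Fintype ι] [DecidableEq ι] (M : Matrix ι ι ℝ) (j : ι) :
    M.map ((↑) : ℝ → ℂ) *ᵥ (Pi.single j (1 : ℂ)) = fun i ↦ ((M *ᵥ Pi.single j (1 : ℝ)) i : ℂ) := by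
  rw [Matrix.mulVec_single_one, Matrix.mulVec_single_one]
  funext i
  rfl

/-- Real parts of `(M ⊗ ℂ) w` for real `M`: `Re((M ⊗ ℂ) w) = M (Re w)`. [folklore] -/
private theorem re_map_ofReal_mulVec_a {ι : Type*} [Fintype ι] (M : Matrix ι ι ℝ) (w : ι → ℂ) :
    (fun i ↦ ((M.map ((↑) : ℝ → ℂ) *ᵥ w) i).re) = M *ᵥ fun i ↦ (w i).re := by
  funext i
  simp only [Matrix.mulVec, dotProduct, Matrix.map_apply, Complex.re_sum, Complex.re_ofReal_mul]

/-- Imaginary parts of `(M ⊗ ℂ) w` for real `M`: `Im((M ⊗ ℂ) w) = M (Im w)`. [folklore] -/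
private theorem im_map_ofReal_mulVec_a {ι : Type*} [Fintype ι] (M : Matrix ι ι ℝ) (w : ι → ℂ) :
    (fun i ↦ ((M.map ((↑) : ℝ → ℂ) *ᵥ w) i).im) = M *ᵥ fun i ↦ (w i).im := by
  funext i
  simp only [Matrix.mulVec, dotProduct, Matrix.map_apply, Complex.im_sum, Complex.im_ofReal_mul]

end Helpers

/-! ### §1 The complexified period map `κ : H₁(X,ℂ) = Λ ⊗ ℂ → E = T_0X` -/

section CxPeriod

variable {ι : Type u} [Fintype ι] [DecidableEq ι] {E : Type*} [NormedAddCommGroup E] [NormedSpace ℂ E]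
  (Φ : (ι → ℝ) ≃L[ℝ] E)

/-- **The `ℂ`-linear extension `κ : Λ ⊗ ℂ = ℂ^ι → E` of the period isomorphism `Φ : Λ ⊗ ℝ ≃ E`**,
`κ(z) = Σ_i z_i Φ(e_i)` — the quotient map `V_ℂ → V_ℂ/F⁰ = V^{-1,0} ≅ (V, J) = Lie(X)`.
[cite: Lange2023AbelianVarietiesComplex, §7.1.1 Prop. 7.1.1 (proof) and §1.1.2 Prop. 1.1.9] [cite: LangeRodriguez2022, §2.2 (2.6), p0029] -/
def cxPeriod : (ι → ℂ) →ₗ[ℂ] E :=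
  ∑ i : ι, (LinearMap.proj i : (ι → ℂ) →ₗ[ℂ] ℂ).smulRight (Φ (Pi.single i 1))

/-- `κ(z) = Σ_i z_i Φ(e_i)`. [cite: Lange2023AbelianVarietiesComplex, §1.1.2 Prop. 1.1.9] -/
theorem cxPeriod_apply (z : ι → ℂ) : cxPeriod Φ z = ∑ i : ι, z i • Φ (Pi.single i 1) := by
  rw [cxPeriod, LinearMap.sum_apply]
  rfl

/-- `Σ_i x_i Φ(e_i) = Φ(x)` for a REAL vector `x`. [folklore] -/
private theorem sum_smul_apply_single (x : ι → ℝ) : ∑ i : ι, x i • Φ (Pi.single i 1) = Φ x := by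
  have hx : x = ∑ i : ι, x i • (Pi.single i (1 : ℝ) : ι → ℝ) := by
    funext j
    simp only [Finset.sum_apply, Pi.smul_apply, Pi.single_apply, smul_eq_mul, mul_ite, mul_one, mul_zero,
      Finset.sum_ite_eq, Finset.mem_univ, if_true]
  conv_rhs => rw [hx, map_sum]
  exact Finset.sum_congr rfl fun i _ ↦ (Φ.map_smul _ _).symm

/-- **`κ(x ⊗ 1) = Φ(x)`**: `κ` extends `Φ`. [cite: Lange2023AbelianVarietiesComplex, §1.1.2 Prop. 1.1.9] -/
theorem cxPeriod_ofReal (x : ι → ℝ) : cxPeriod Φ (fun i ↦ (x i : ℂ)) = Φ x := by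
  rw [cxPeriod_apply, ← sum_smul_apply_single Φ x]
  exact Finset.sum_congr rfl fun i _ ↦ Complex.coe_smul _ _

/-- `κ(e_j) = Φ(e_j)`: on the lattice basis `κ` is the period map. [cite: Lange2023AbelianVarietiesComplex, §1.1.2 Prop. 1.1.9 (`ρ_r ⊗ 1`), §1.1.1 (the period matrix)] -/
theorem cxPeriod_single (j : ι) : cxPeriod Φ (Pi.single j 1) = Φ (Pi.single j 1) := by
  rw [single_eq_ofReal_single_a, cxPeriod_ofReal]

/-- **`κ(w) = Φ(Re w) + i Φ(Im w)`.** [cite: Lange2023AbelianVarietiesComplex, §1.1.2 Prop. 1.1.9] -/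
theorem cxPeriod_eq_re_add_im (w : ι → ℂ) :
    cxPeriod Φ w = Φ (fun i ↦ (w i).re) + Complex.I • Φ (fun i ↦ (w i).im) := by
  rw [cxPeriod_apply, ← sum_smul_apply_single Φ (fun i ↦ (w i).re), ← sum_smul_apply_single Φ (fun i ↦ (w i).im),
    Finset.smul_sum, ← Finset.sum_add_distrib]
  refine Finset.sum_congr rfl fun i _ ↦ ?_
  rw [← Complex.coe_smul, ← Complex.coe_smul, smul_smul, ← add_smul]
  congr 1
  rw [mul_comm]
  exact (Complex.re_add_im (w i)).symm

/-- **`κ` is surjective** (already `Φ` is). [cite: Lange2023AbelianVarietiesComplex, §7.1.1 Prop. 7.1.1 (`V_ℂ → V_ℂ/F⁰ ≅ Lie X`)] -/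
theorem cxPeriod_surjective : Function.Surjective (cxPeriod Φ) := fun v ↦
  ⟨fun i ↦ ((Φ.symm v) i : ℂ), by rw [cxPeriod_ofReal, ContinuousLinearEquiv.apply_symm_apply]⟩

/-- **Intertwining from a real intertwining**: if `L(Φ x) = Φ(M x)` for all real `x` (`L` `ℂ`-linear on `E`), then
`κ ∘ (M ⊗ ℂ) = L ∘ κ`. [cite: Lange2023AbelianVarietiesComplex, §1.1.2 Props. 1.1.6 and 1.1.9] -/
theorem cxPeriod_comp_toLin'_map_ofReal {M : Matrix ι ι ℝ} {L : E →ₗ[ℂ] E}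
    (hL : ∀ x : ι → ℝ, L (Φ x) = Φ (M *ᵥ x)) :
    cxPeriod Φ ∘ₗ Matrix.toLin' (M.map ((↑) : ℝ → ℂ)) = L ∘ₗ cxPeriod Φ := by
  refine (Pi.basisFun ℂ ι).ext fun j ↦ ?_
  rw [Pi.basisFun_apply, LinearMap.comp_apply, LinearMap.comp_apply, Matrix.toLin'_apply,
    map_ofReal_mulVec_single_a, cxPeriod_ofReal, cxPeriod_single, hL]

/-- Pointwise form: `κ((M ⊗ ℂ) z) = L(κ z)`. [cite: Lange2023AbelianVarietiesComplex, §1.1.2 Props. 1.1.6 and 1.1.9] -/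
theorem cxPeriod_map_ofReal_mulVec {M : Matrix ι ι ℝ} {L : E →ₗ[ℂ] E}
    (hL : ∀ x : ι → ℝ, L (Φ x) = Φ (M *ᵥ x)) (z : ι → ℂ) :
    cxPeriod Φ (M.map ((↑) : ℝ → ℂ) *ᵥ z) = L (cxPeriod Φ z) := by
  have h := LinearMap.congr_fun (cxPeriod_comp_toLin'_map_ofReal Φ hL) z
  rwa [LinearMap.comp_apply, LinearMap.comp_apply, Matrix.toLin'_apply] at h

/-- **`κ ∘ J_ℂ = i · κ`**: the complex structure `J` of `X` becomes multiplication by `i` on `E`.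
[cite: Lange2023AbelianVarietiesComplex, §7.1.1 Prop. 7.1.1 (proof: `J` acts on `V^{-1,0}` as `i`)] -/
theorem cxPeriod_jMatrix_mulVec (z : ι → ℂ) :
    cxPeriod Φ ((jMatrix Φ).map ((↑) : ℝ → ℂ) *ᵥ z) = Complex.I • cxPeriod Φ z := by
  have h := cxPeriod_map_ofReal_mulVec Φ (M := jMatrix Φ) (L := Complex.I • LinearMap.id) (fun x ↦ by
    rw [LinearMap.smul_apply, LinearMap.id_apply, jMatrix_mulVec, apply_latticeJ]) z
  rwa [LinearMap.smul_apply, LinearMap.id_apply] at h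

variable {Φ} {G : Type*} [Group G] (ρ : G →* endAlgRat Φ)

/-- **`κ ∘ (ρ(g) ⊗ 1) = ρ_a(g) ∘ κ`** (`ρ_a = tangentRep ρ`). [cite: LangeRodriguez2022, §2.2 (2.6), p0029] [cite: Lange2023AbelianVarietiesComplex, §1.1.2 Prop. 1.1.9] -/
theorem cxPeriod_map_ratCast_mulVec (g : G) (z : ι → ℂ) :
    cxPeriod Φ (((ρ g : endAlgRat Φ) : Matrix ι ι ℚ).map (Rat.cast : ℚ → ℂ) *ᵥ z) = tangentRep ρ g (cxPeriod Φ z) := by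
  rw [map_ratCast_complex_a]
  exact cxPeriod_map_ofReal_mulVec Φ (fun x ↦ tangentRep_apply_apply ρ g x) z

/-- **`κ ∘ ρ_ℂ(x) = ρ_a(x) ∘ κ` for every `x ∈ ℂ[G]`.** [cite: LangeRodriguez2022, §2.2 (2.6) and §2.9.2, p0029, p0046] -/
theorem cxPeriod_complexGroupAlgebraRep_mulVec (x : MonoidAlgebra ℂ G) (z : ι → ℂ) :
    cxPeriod Φ (complexGroupAlgebraRep ρ x *ᵥ z) = (tangentRep ρ).asAlgebraHom x (cxPeriod Φ z) := by
  induction x using MonoidAlgebra.induction_on generalizing z with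
  | hM g => rw [complexGroupAlgebraRep_of, Representation.asAlgebraHom_of, cxPeriod_map_ratCast_mulVec]
  | hadd x y hx hy => rw [map_add, map_add, Matrix.add_mulVec, map_add, hx, hy, LinearMap.add_apply]
  | hsmul r x hx => rw [map_smul, map_smul, Matrix.smul_mulVec, map_smul, hx, LinearMap.smul_apply]

/-- **`κ` kills `V^{0,-1}`**: if `J_ℂ w = -i w` then `κ(w) = 0` (`i κ(w) = κ(J_ℂ w) = -i κ(w)`).
[cite: Lange2023AbelianVarietiesComplex, §7.1.1 Prop. 7.1.1 (`V_ℂ/F⁰ ≅ V^{-1,0}`, `F⁰ = V^{0,-1}`)] -/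
theorem cxPeriod_eq_zero_of_jMatrix_mulVec_eq_neg {w : ι → ℂ}
    (hw : (jMatrix Φ).map ((↑) : ℝ → ℂ) *ᵥ w = -(Complex.I • w)) : cxPeriod Φ w = 0 := by
  have h1 := cxPeriod_jMatrix_mulVec Φ w
  rw [hw, map_neg, map_smul] at h1
  -- `-(i κ w) = i κ w`
  have h2 : ((2 : ℂ) * Complex.I) • cxPeriod Φ w = 0 := by
    rw [mul_smul, two_smul]
    nth_rewrite 1 [← h1]
    exact neg_add_cancel _
  rcases smul_eq_zero.1 h2 with h3 | h3
  · exact absurd h3 (mul_ne_zero two_ne_zero Complex.I_ne_zero)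
  · exact h3

/-- **`κ` is injective on `V^{-1,0}`**: if `J_ℂ w = i w` and `κ(w) = 0` then `w = 0` (`J Re w = -Im w`,
`J Im w = Re w`, `κ(w) = Φ(Re w) + Φ(J Im w) = 2 Φ(Re w)`).
[cite: Lange2023AbelianVarietiesComplex, §7.1.1 Prop. 7.1.1 (`V^{-1,0} ≅ (V, J)`)] -/
theorem eq_zero_of_jMatrix_mulVec_eq_of_cxPeriod_eq_zero {w : ι → ℂ}
    (hw : (jMatrix Φ).map ((↑) : ℝ → ℂ) *ᵥ w = Complex.I • w) (h0 : cxPeriod Φ w = 0) : w = 0 := by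
  -- real and imaginary parts of `J_ℂ w = i w`
  have hre : jMatrix Φ *ᵥ (fun i ↦ (w i).re) = -fun i ↦ (w i).im := by
    rw [← re_map_ofReal_mulVec_a, hw]
    funext i
    simp only [Pi.smul_apply, smul_eq_mul, Complex.I_mul_re, Pi.neg_apply]
  have him : jMatrix Φ *ᵥ (fun i ↦ (w i).im) = fun i ↦ (w i).re := by
    rw [← im_map_ofReal_mulVec_a, hw]
    funext i
    simp only [Pi.smul_apply, smul_eq_mul, Complex.I_mul_im]
  -- `κ w = 2 Φ(Re w) = 0`
  rw [cxPeriod_eq_re_add_im, ← apply_latticeJ, ← jMatrix_mulVec, him, ← two_smul ℝ, smul_eq_zero] at h0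
  have hre0 : (fun i ↦ (w i).re) = 0 := by
    rcases h0 with h | h
    · exact absurd h two_ne_zero
    · exact Φ.injective (by rw [h, map_zero])
  have him0 : (fun i ↦ (w i).im) = 0 := by
    have h := congrArg (fun v ↦ jMatrix Φ *ᵥ v) him
    simp only [Matrix.mulVec_mulVec, jMatrix_mul_jMatrix, Matrix.neg_mulVec, Matrix.one_mulVec] at h
    rw [hre0, Matrix.mulVec_zero, neg_eq_zero] at h
    exact h
  funext i
  apply Complex.ext
  · simpa using congrFun hre0 i
  · simpa using congrFun him0 i

end CxPeriod

/-! ### §2 The bridge: `ρ_a(x) = 0` iff `J_ℂ ρ_ℂ(x) = -i ρ_ℂ(x)` -/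

section Bridge

variable {ι : Type u} [Fintype ι] [DecidableEq ι] {E : Type*} [NormedAddCommGroup E] [NormedSpace ℂ E]
  {Φ : (ι → ℝ) ≃L[ℝ] E} {G : Type*} [Group G] (ρ : G →* endAlgRat Φ)

/-- `J_ℂ` commutes with every `ρ_ℂ(x)` (the `ρ(g)` are endomorphisms of `X`). [cite: Lange2023AbelianVarietiesComplex, §1.1.2 Prop. 1.1.6] -/
theorem map_ofReal_jMatrix_mul_complexGroupAlgebraRep (x : MonoidAlgebra ℂ G) :
    (jMatrix Φ).map ((↑) : ℝ → ℂ) * complexGroupAlgebraRep ρ x =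
      complexGroupAlgebraRep ρ x * (jMatrix Φ).map ((↑) : ℝ → ℂ) := by
  induction x using MonoidAlgebra.induction_on with
  | hM g =>
    rw [complexGroupAlgebraRep_of, map_ratCast_complex_a, ← map_ofReal_mul_a, ← map_ofReal_mul_a,
      (mem_endAlgRat_iff Φ _).1 (ρ g).2]
  | hadd x y hx hy => rw [map_add, mul_add, add_mul, hx, hy]
  | hsmul r x hx => rw [map_smul, Matrix.mul_smul, Matrix.smul_mul, hx]

/-- **THE BRIDGE.  `ρ_a(x) = 0` on `T_0X` iff `ρ_ℂ(x)` maps `H₁(X,ℂ)` into `V^{0,-1}`: `J_ℂ ρ_ℂ(x) = -i ρ_ℂ(x)`**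
(`⟸`: `κ` kills `V^{0,-1}` and `κ ∘ ρ_ℂ(x) = ρ_a(x) ∘ κ` with `κ` onto; `⟹`: `Q = ρ_ℂ(x) - i J_ℂ ρ_ℂ(x)` has
`J_ℂ Q = i Q` and `κ Q = 0`, so `Q = 0`). [cite: LangeRodriguez2022, §2.2 (2.6), p0029] [cite: Lange2023AbelianVarietiesComplex, §7.1.1 Prop. 7.1.1 and §1.1.2 Prop. 1.1.9] -/
theorem asAlgebraHom_tangentRep_eq_zero_iff (x : MonoidAlgebra ℂ G) :
    (tangentRep ρ).asAlgebraHom x = 0 ↔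
      (jMatrix Φ).map ((↑) : ℝ → ℂ) * complexGroupAlgebraRep ρ x = -(Complex.I • complexGroupAlgebraRep ρ x) := by
  have hJJ : (jMatrix Φ).map ((↑) : ℝ → ℂ) * (jMatrix Φ).map ((↑) : ℝ → ℂ) = -1 := map_ofReal_jMatrix_mul_self
  constructor
  · intro h
    -- `Q := P - i J_ℂ P` satisfies `J_ℂ Q = i Q` …
    have hJQ : (jMatrix Φ).map ((↑) : ℝ → ℂ) *
        (complexGroupAlgebraRep ρ x - Complex.I • ((jMatrix Φ).map ((↑) : ℝ → ℂ) * complexGroupAlgebraRep ρ x)) =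
        Complex.I •
          (complexGroupAlgebraRep ρ x - Complex.I • ((jMatrix Φ).map ((↑) : ℝ → ℂ) * complexGroupAlgebraRep ρ x)) := by
      rw [Matrix.mul_sub, Matrix.mul_smul, ← Matrix.mul_assoc, hJJ, Matrix.neg_mul, Matrix.one_mul, smul_neg,
        sub_neg_eq_add, smul_sub, smul_smul, Complex.I_mul_I, neg_smul, one_smul, sub_neg_eq_add, add_comm]
    -- … and `κ Q = 0`, hence `Q = 0`
    have hQ : complexGroupAlgebraRep ρ x - Complex.I • ((jMatrix Φ).map ((↑) : ℝ → ℂ) * complexGroupAlgebraRep ρ x) = 0 := by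
      refine Matrix.toLin'.injective (LinearMap.ext fun z ↦ ?_)
      rw [map_zero, LinearMap.zero_apply, Matrix.toLin'_apply]
      apply eq_zero_of_jMatrix_mulVec_eq_of_cxPeriod_eq_zero (Φ := Φ)
      · rw [Matrix.mulVec_mulVec, hJQ, Matrix.smul_mulVec]
      · rw [Matrix.sub_mulVec, Matrix.smul_mulVec, map_sub, map_smul, ← Matrix.mulVec_mulVec,
          cxPeriod_jMatrix_mulVec, cxPeriod_complexGroupAlgebraRep_mulVec, h, LinearMap.zero_apply, smul_zero,
          smul_zero, sub_zero]
    -- so `P = i J_ℂ P` and `J_ℂ P = i J_ℂ² P = -i P`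
    have hPJ : complexGroupAlgebraRep ρ x = Complex.I • ((jMatrix Φ).map ((↑) : ℝ → ℂ) * complexGroupAlgebraRep ρ x) :=
      sub_eq_zero.1 hQ
    calc (jMatrix Φ).map ((↑) : ℝ → ℂ) * complexGroupAlgebraRep ρ x
        = (jMatrix Φ).map ((↑) : ℝ → ℂ) *
            (Complex.I • ((jMatrix Φ).map ((↑) : ℝ → ℂ) * complexGroupAlgebraRep ρ x)) := by rw [← hPJ]
      _ = -(Complex.I • complexGroupAlgebraRep ρ x) := by
          rw [Matrix.mul_smul, ← Matrix.mul_assoc, hJJ, Matrix.neg_mul, Matrix.one_mul, smul_neg]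
  · intro h
    refine LinearMap.ext fun v ↦ ?_
    obtain ⟨z, rfl⟩ := cxPeriod_surjective Φ v
    rw [LinearMap.zero_apply, ← cxPeriod_complexGroupAlgebraRep_mulVec]
    apply cxPeriod_eq_zero_of_jMatrix_mulVec_eq_neg
    rw [Matrix.mulVec_mulVec, h, Matrix.neg_mulVec, Matrix.smul_mulVec]

end Bridge

/-! ### §3 THE ANALYTIC CRITERION -/

section Criterion

variable {ι : Type u} [Fintype ι] [DecidableEq ι] {E : Type*} [NormedAddCommGroup E] [NormedSpace ℂ E]
  {Φ : (ι → ℝ) ≃L[ℝ] E} {G : Type} [Group G] [Fintype G] (ρ : G →* endAlgRat Φ)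

/-- Conjugating `J_ℂ P_{χ̄} = -i P_{χ̄}` gives `J_ℂ P_χ = i P_χ` and conversely (FILE 4's `\overline{P_χ} = P_{χ̄}`;
`J_ℂ` is real). [cite: JamesLiebeck2001, §13 Prop. 13.15, held chunk p0081] [cite: LangeRodriguez2022, §2.2 (2.6), p0029] -/
theorem jMatrix_mul_charIdempotent_star_eq_neg_iff (χ : G → ℂ) :
    (jMatrix Φ).map ((↑) : ℝ → ℂ) * complexGroupAlgebraRep ρ (charIdempotent (star χ)) =
        -(Complex.I • complexGroupAlgebraRep ρ (charIdempotent (star χ))) ↔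
      (jMatrix Φ).map ((↑) : ℝ → ℂ) * complexGroupAlgebraRep ρ (charIdempotent χ) =
        Complex.I • complexGroupAlgebraRep ρ (charIdempotent χ) := by
  rw [← map_conj_injective_a.eq_iff]
  simp only [map_conj_mul_a, map_conj_neg_a, map_conj_smul_a, map_conj_map_ofReal_a,
    map_conj_complexGroupAlgebraRep_charIdempotent, star_star, Complex.conj_I, neg_smul, neg_neg]

/-- **`ρ_a(e_{χ̄}) = 0 ⟺ J_ℂ P_χ = +i P_χ`** (the `χ`-isotypic component of `H₁(X,ℂ)` lies in `V^{-1,0} = T_0X`).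
[cite: LangeRodriguez2022, §2.2 (2.6), p0029] [cite: Lange2023AbelianVarietiesComplex, §7.1.1 Prop. 7.1.1] -/
theorem asAlgebraHom_tangentRep_charIdempotent_star_eq_zero_iff (χ : G → ℂ) :
    (tangentRep ρ).asAlgebraHom (charIdempotent (star χ)) = 0 ↔
      (jMatrix Φ).map ((↑) : ℝ → ℂ) * complexGroupAlgebraRep ρ (charIdempotent χ) =
        Complex.I • complexGroupAlgebraRep ρ (charIdempotent χ) := by
  rw [asAlgebraHom_tangentRep_eq_zero_iff, jMatrix_mul_charIdempotent_star_eq_neg_iff]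

/-- **THE ANALYTIC CRITERION.  `End_ℚ^G(X) = End_{ℚ[G]}(H₁(X,ℚ))` iff for every irreducible character `χ` of `G`
at least one of `ρ_a(e_χ)`, `ρ_a(e_{χ̄})` vanishes on `T_0X`** — i.e. iff no irreducible representation of `G`
occurs both in the analytic representation `ρ_a` and in its complex conjugate `ρ̄_a` (`ρ_r ⊗ ℂ ≅ ρ_a ⊕ ρ̄_a`: each
isotypic component of `H₁(X,ℂ)` lies entirely in `T_0X = V^{-1,0}` or entirely in `V^{0,-1}`).
[cite: LangeRodriguez2022, §2.2 (2.6)–(2.8), p0029; §2.9.2, p0046] [cite: DolgachevZarhin2024, §2.2 Remark 2.17, (2.18) and Thm. 2.18, p0035–p0036]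
[cite: Lange2023AbelianVarietiesComplex, §1.1.2 Prop. 1.1.9 and §7.1.1 Prop. 7.1.1] -/
theorem endAlgRatG_eq_centralizer_iff_forall_tangentRep :
    endAlgRatG Φ ρ = Subalgebra.centralizer ℚ (Set.range fun g : G ↦ ((ρ g : endAlgRat Φ) : Matrix ι ι ℚ)) ↔
      ∀ χ : G → ℂ, IsIrrChar G χ →
        (tangentRep ρ).asAlgebraHom (charIdempotent χ) = 0 ∨
          (tangentRep ρ).asAlgebraHom (charIdempotent (star χ)) = 0 := by
  constructor
  · intro h χ hχ
    rcases jMatrix_mul_charIdempotent_eq_I_smul_or ρ h hχ with h1 | h1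
    · exact Or.inr ((asAlgebraHom_tangentRep_charIdempotent_star_eq_zero_iff ρ χ).2 h1)
    · refine Or.inl ((asAlgebraHom_tangentRep_eq_zero_iff ρ _).2 ?_)
      rw [h1, neg_smul]
  · intro h
    refine endAlgRatG_eq_centralizer_of_forall_exists_jMatrix_mul_eq_smul ρ fun χ hχ ↦ ?_
    rcases h χ hχ with h1 | h1
    · refine ⟨-Complex.I, ?_⟩
      rw [(asAlgebraHom_tangentRep_eq_zero_iff ρ _).1 h1, neg_smul]
    · exact ⟨Complex.I, (asAlgebraHom_tangentRep_charIdempotent_star_eq_zero_iff ρ χ).1 h1⟩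

/-- **A real-valued irreducible character is absent from the analytic representation in the equality case**:
`χ̄ = χ` and equality ⟹ `ρ_a(e_χ) = 0` (FILE 2 / FILE 4 on the analytic side).
[cite: JamesLiebeck2001, §23 Thm. 23.1 (real characters), held chunk p0183] [cite: DolgachevZarhin2024, §2.2 Remark 2.17, p0035] -/
theorem asAlgebraHom_tangentRep_charIdempotent_eq_zero_of_star_eq
    (h : endAlgRatG Φ ρ = Subalgebra.centralizer ℚ (Set.range fun g : G ↦ ((ρ g : endAlgRat Φ) : Matrix ι ι ℚ)))
    {χ : G → ℂ} (hχ : IsIrrChar G χ) (hr : star χ = χ) : (tangentRep ρ).asAlgebraHom (charIdempotent χ) = 0 := by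
  rcases (endAlgRatG_eq_centralizer_iff_forall_tangentRep ρ).1 h χ hχ with h1 | h1
  · exact h1
  · rwa [hr] at h1

end Criterion

/-! ### §4 In terms of characters: `⟨χ, χ_a⟩ ⟨χ, \overline{χ_a}⟩ = 0` for all `χ ∈ Irr(G)` -/

section Characters

variable {ι : Type u} [Fintype ι] [DecidableEq ι] {E : Type*} [NormedAddCommGroup E] [NormedSpace ℂ E]
  [FiniteDimensional ℂ E] {Φ : (ι → ℝ) ≃L[ℝ] E} {G : Type} [Group G] [Fintype G] (ρ : G →* endAlgRat Φ)

/-- **`ρ_a(e_χ) = 0 ⟺ ⟨χ, χ_a⟩ = 0`** for `χ ∈ Irr(G)`: `ρ_a(e_χ)` is the isotypic projector, an idempotent of trace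
`χ(1)⟨χ, χ_a⟩`. [cite: SerreLinearRepresentations1977, §2.6 Thm. 8] [cite: Isaacs1976, Thm. 2.12 and Ch. 3 p. 36, p0024, p0040] -/
theorem asAlgebraHom_tangentRep_charIdempotent_eq_zero_iff_classInner {χ : G → ℂ} (hχ : IsIrrChar G χ) :
    (tangentRep ρ).asAlgebraHom (charIdempotent χ) = 0 ↔ classInner χ (tangentRep ρ).character = 0 := by
  have htr : LinearMap.trace ℂ E ((tangentRep ρ).asAlgebraHom (charIdempotent χ)) =
      χ 1 * classInner χ (tangentRep ρ).character := by
    rw [Representation.asAlgebraHom_charIdempotent, trace_isotypicProj]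
  constructor
  · intro h
    rw [h, map_zero] at htr
    exact (mul_eq_zero.1 htr.symm).resolve_left hχ.apply_one_ne_zero
  · intro h
    have hidem : IsIdempotentElem ((tangentRep ρ).asAlgebraHom (charIdempotent χ)) :=
      (isIdempotentElem_charIdempotent hχ).map _
    have hproj := LinearMap.IsIdempotentElem.isProj_range _ hidem
    have hrank : (finrank ℂ (LinearMap.range ((tangentRep ρ).asAlgebraHom (charIdempotent χ))) : ℂ) = 0 := by
      rw [← hproj.trace, htr, h, mul_zero]
    have hbot : LinearMap.range ((tangentRep ρ).asAlgebraHom (charIdempotent χ)) = ⊥ :=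
      Submodule.finrank_eq_zero.1 (by exact_mod_cast hrank)
    exact LinearMap.range_eq_bot.1 hbot

/-- `⟨χ̄, χ_a⟩ = 0 ⟺ ⟨χ, \overline{χ_a}⟩ = 0`: the multiplicity of `χ̄` in `ρ_a` is that of `χ` in `ρ̄_a`.
[cite: JamesLiebeck2001, §13 Prop. 13.15 (`⟨χ̄, ψ̄⟩ = \overline{⟨χ, ψ⟩}`), held chunk p0081] -/
theorem classInner_star_left_eq_zero_iff (χ ψ : G → ℂ) : classInner (star χ) ψ = 0 ↔ classInner χ (star ψ) = 0 := by
  rw [← star_star ψ, classInner_star_star, star_star, map_eq_zero]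

/-- **THE ANALYTIC CRITERION IN CHARACTERS.  `End_ℚ^G(X) = End_{ℚ[G]}(H₁(X,ℚ))` iff `⟨χ, χ_a⟩ = 0` or
`⟨χ, \overline{χ_a}⟩ = 0` for every irreducible character `χ`** — the analytic representation `ρ_a` of `G` on `T_0X`
and its complex conjugate `ρ̄_a` have NO irreducible constituent in common.  (`G = {1}`: `ρ_a = ρ̄_a = g · 1`, never
for `X ≠ 0`; `G = ⟨δ⟩` of prime order `ℓ` with `Φ_ℓ(δ) = 0` acting on `A`: the eigenvalue multiplicities
`n_k = ⟨χ_k, χ_a⟩` must satisfy `n_k n_{-k} = 0`, Dolgachev–Zarhin's second alternative.)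
[cite: LangeRodriguez2022, §2.2 (2.6)–(2.8), p0029] [cite: DolgachevZarhin2024, §2.2 Remark 2.17, (2.18) and Thm. 2.18, p0035–p0036]
[cite: Lange2023AbelianVarietiesComplex, §1.1.2 Prop. 1.1.9] [cite: SerreLinearRepresentations1977, §2.6 Thm. 8] -/
theorem endAlgRatG_eq_centralizer_iff_forall_classInner :
    endAlgRatG Φ ρ = Subalgebra.centralizer ℚ (Set.range fun g : G ↦ ((ρ g : endAlgRat Φ) : Matrix ι ι ℚ)) ↔
      ∀ χ : G → ℂ, IsIrrChar G χ →
        classInner χ (tangentRep ρ).character = 0 ∨ classInner χ (star (tangentRep ρ).character) = 0 := by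
  rw [endAlgRatG_eq_centralizer_iff_forall_tangentRep]
  refine forall₂_congr fun χ hχ ↦ ?_
  rw [asAlgebraHom_tangentRep_charIdempotent_eq_zero_iff_classInner ρ hχ,
    asAlgebraHom_tangentRep_charIdempotent_eq_zero_iff_classInner ρ hχ.star, classInner_star_left_eq_zero_iff]

/-- **A common irreducible constituent of `ρ_a` and `ρ̄_a` forces `End_ℚ^G(X) ⊊ End_{ℚ[G]}(H₁(X,ℚ))`.**
[cite: DolgachevZarhin2024, §2.2 Remark 2.17 (`d ≤ r²` and the equality case), p0035] [cite: LangeRodriguez2022, §2.2 (2.6), p0029] -/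
theorem endAlgRatG_ne_centralizer_of_classInner_ne_zero {χ : G → ℂ} (hχ : IsIrrChar G χ)
    (h₁ : classInner χ (tangentRep ρ).character ≠ 0) (h₂ : classInner χ (star (tangentRep ρ).character) ≠ 0) :
    endAlgRatG Φ ρ ≠ Subalgebra.centralizer ℚ (Set.range fun g : G ↦ ((ρ g : endAlgRat Φ) : Matrix ι ι ℚ)) := by
  intro h
  rcases (endAlgRatG_eq_centralizer_iff_forall_classInner ρ).1 h χ hχ with h0 | h0
  · exact h₁ h0
  · exact h₂ h0

/-- In the equality case **a real-valued irreducible character has multiplicity `0` in `ρ_a`**: `⟨χ, χ_a⟩ = 0`.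
[cite: JamesLiebeck2001, §23 Thm. 23.1, held chunk p0183] [cite: DolgachevZarhin2024, §2.2 Remark 2.17, p0035] -/
theorem classInner_tangentRep_eq_zero_of_star_eq
    (h : endAlgRatG Φ ρ = Subalgebra.centralizer ℚ (Set.range fun g : G ↦ ((ρ g : endAlgRat Φ) : Matrix ι ι ℚ)))
    {χ : G → ℂ} (hχ : IsIrrChar G χ) (hr : star χ = χ) : classInner χ (tangentRep ρ).character = 0 :=
  (asAlgebraHom_tangentRep_charIdempotent_eq_zero_iff_classInner ρ hχ).1
    (asAlgebraHom_tangentRep_charIdempotent_eq_zero_of_star_eq ρ h hχ hr)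

end Characters

end ComplexTorus

end Literature.Geometry.Kaehler
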